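import Mathlib.Algebra.Group.End
import Mathlib.Algebra.Group.Pi.Lemmas
import Mathlib.Data.Complex.Basic
import Mathlib.Data.Fintype.BigOperators
import Mathlib.Data.Fintype.EquivFin
import Mathlib.LinearAlgebra.Pi
import Mathlib.LinearAlgebra.Span.Basic
import Mathlib.Logic.Equiv.Fin.Basic

/-!
# Colour-cell universality: the blow-up `𝔖ₘ →* 𝔖ₘₛ` (stub `colourSeparated_blowup`)

Crux `stmt-MatrixMultiplication-7610`
(`Summit.MatrixMultiplication.MatrixMultiplication.Theses.LevelGradedCohnUmans.GradedDesignFamily`),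
line `schur-weyl-colour-cells`, registered stub `colourSeparated_blowup` (colour-cell universality):
the blow-up `𝔖ₘ →* 𝔖_{m s}` (every point becomes a block of `s` points, permuted in parallel)
carries `J_r(m)`-separated triples, `r ≤ 2^s`, to `J_2(m s)`-separated triples of the same volume,
where `J_r(n) = span_ℂ {g ↦ [c' ∘ g = c] : c, c' : [n] → [r]}` is the `r`-colour cell.

## Proof (Mathlib API route)

* The blow-up is assembled from bundled Mathlib homomorphisms: the diagonal
  `Pi.constMonoidHom (Fin s) (Perm (Fin m))`, then `Equiv.Perm.sigmaCongrRightHom` into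
  `Perm (Σ _ : Fin s, Fin m)`, then `Equiv.permCongrHom e` for an explicit
  `e : (Σ _ : Fin s, Fin m) ≃ Fin (m * s)` (`Equiv.sigmaEquivProd`, `Equiv.prodComm`,
  `finProdFinEquiv`); injectivity is `Function.const_injective` (here `1 ≤ s` is used) composed
  with `sigmaCongrRightHom_injective` and the injectivity of a `MulEquiv`.
* An `r`-colouring `c : Fin m → Fin r` is encoded by the `2`-colouring
  `k ↦ enc (c i) j` of `Fin (m * s)` (`k ↔ ⟨j, i⟩` under `e`), where `enc : Fin r ↪ (Fin s → Fin 2)`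
  exists by `Function.Embedding.nonempty_of_card_le` (`r ≤ 2^s = #(Fin s → Fin 2)`); then
  `[C' ∘ ι g = C] = [c' ∘ g = c]` (`sigmaBlowup_exists`).
* Pulling back along `ι` is the linear map `LinearMap.funLeft ℂ ℂ ι`; by `Submodule.map_span` the
  image of `J_2(m s)` contains `J_r(m)` (`sigmaBlowup_span_transfer`), and the separation pattern
  transfers through `map_mul`, `map_inv` and injectivity (`colourSeparated_blowup`).

No new definitions are introduced (the homomorphism is a composite of Mathlib's bundled maps built
inside the proofs).  The declarations live in the sub-namespace
`….Theorems.GradedDesignFamily.SigmaBlowup` so that this sigma-type construction coexists with the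
sibling file `LevelGradedCohnUmansGradedDesignFamilyColourBlowup.lean` (an independent construction
of the same registered stub); the stub is proved here by name and verbatim signature.
-/

set_option linter.dupNamespace false

noncomputable section

namespace Summit.MatrixMultiplication.MatrixMultiplication.Theorems.GradedDesignFamily.SigmaBlowup

open Equiv

/-- **The blow-up homomorphism.** For `1 ≤ s` and `r ≤ 2^s` there is an injective group
homomorphism `ι : Perm (Fin m) →* Perm (Fin (m * s))` (each point of `[m]` becomes a block of `s`
points permuted in parallel) such that every pair of `r`-colourings `c, c'` of `[m]` has a pair of
`2`-colourings `C, C'` of `[m s]` with `C' ∘ ι g = C ↔ c' ∘ g = c` for all `g`. [folklore] -/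
theorem sigmaBlowup_exists (m s r : ℕ) (hs : 1 ≤ s) (hr : r ≤ 2 ^ s) :
    ∃ ι : Perm (Fin m) →* Perm (Fin (m * s)), Function.Injective ι ∧
      ∀ c c' : Fin m → Fin r, ∃ C C' : Fin (m * s) → Fin 2,
        ∀ g : Perm (Fin m), (C' ∘ (⇑(ι g)) = C ↔ c' ∘ (⇑g) = c) := by
  -- binary encoding of the `r` colours by `s` bits
  obtain ⟨enc⟩ : Nonempty (Fin r ↪ (Fin s → Fin 2)) :=
    Function.Embedding.nonempty_of_card_le (by simpa [Fintype.card_fun] using hr)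
  -- the blow-up, on `Σ _ : Fin s, Fin m` and transported to `Fin (m * s)`
  let e : (Σ _ : Fin s, Fin m) ≃ Fin (m * s) :=
    (Equiv.sigmaEquivProd (Fin s) (Fin m)).trans ((Equiv.prodComm _ _).trans finProdFinEquiv)
  let ι : Perm (Fin m) →* Perm (Fin (m * s)) :=
    e.permCongrHom.toMonoidHom.comp
      ((Perm.sigmaCongrRightHom fun _ : Fin s => Fin m).comp
        (Pi.constMonoidHom (Fin s) (Perm (Fin m))))
  have hι : ∀ (g : Perm (Fin m)) (k : Fin (m * s)), ι g k = e ⟨(e.symm k).1, g (e.symm k).2⟩ := by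
    intro g k
    simp [ι, Equiv.permCongrHom_coe, Equiv.permCongr_apply]
  haveI : Nonempty (Fin s) := ⟨⟨0, hs⟩⟩
  refine ⟨ι, ?_, fun c c' => ?_⟩
  · exact e.permCongrHom.injective.comp
      (Perm.sigmaCongrRightHom_injective.comp Function.const_injective)
  · refine ⟨fun k => enc (c (e.symm k).2) (e.symm k).1,
      fun k => enc (c' (e.symm k).2) (e.symm k).1, fun g => ⟨fun h => ?_, fun h => ?_⟩⟩
    · funext i
      apply enc.injective
      funext j
      have := congrFun h (e ⟨j, i⟩)
      simpa [hι] using this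
    · funext k
      have := congrFun h (e.symm k).2
      simp only [Function.comp_apply] at this
      simp [hι, this]

/-- **Pull-back of colour tests along the blow-up.** If `ι` carries pairs of `r`-colourings of `[m]`
to pairs of `2`-colourings of `[n]` with `[C' ∘ ι g = C] = [c' ∘ g = c]`, then every `f` in the
`r`-colour cell `J_r(m)` is the pull-back `F ∘ ι` of some `F` in the two-colour cell `J_2(n)`
(linear-algebra bookkeeping: `LinearMap.funLeft`, `Submodule.map_span`). [folklore] -/
theorem sigmaBlowup_span_transfer {m n r : ℕ} (ι : Perm (Fin m) →* Perm (Fin n))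
    (hι : ∀ c c' : Fin m → Fin r, ∃ C C' : Fin n → Fin 2,
      ∀ g : Perm (Fin m), (C' ∘ (⇑(ι g)) = C ↔ c' ∘ (⇑g) = c))
    {f : Perm (Fin m) → ℂ}
    (hf : f ∈ Submodule.span ℂ {f : Perm (Fin m) → ℂ |
      ∃ c c' : Fin m → Fin r, f = fun g : Perm (Fin m) => if c' ∘ (⇑g) = c then (1 : ℂ) else 0}) :
    ∃ F ∈ Submodule.span ℂ {f : Perm (Fin n) → ℂ |
        ∃ c c' : Fin n → Fin 2, f = fun g : Perm (Fin n) => if c' ∘ (⇑g) = c then (1 : ℂ) else 0},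
      ∀ g : Perm (Fin m), F (ι g) = f g := by
  set S := {f : Perm (Fin m) → ℂ |
      ∃ c c' : Fin m → Fin r, f = fun g : Perm (Fin m) => if c' ∘ (⇑g) = c then (1 : ℂ) else 0}
  set T := {f : Perm (Fin n) → ℂ |
      ∃ c c' : Fin n → Fin 2, f = fun g : Perm (Fin n) => if c' ∘ (⇑g) = c then (1 : ℂ) else 0}
  have hsub : S ⊆ (LinearMap.funLeft ℂ ℂ ⇑ι) '' T := by
    rintro _ ⟨c, c', rfl⟩
    obtain ⟨C, C', hC⟩ := hι c c'
    refine ⟨fun G => if C' ∘ (⇑G) = C then (1 : ℂ) else 0, ⟨C, C', rfl⟩, ?_⟩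
    funext g
    simp only [LinearMap.funLeft_apply, hC g]
  have hle : Submodule.span ℂ S ≤ (Submodule.span ℂ T).map (LinearMap.funLeft ℂ ℂ ⇑ι) := by
    rw [Submodule.map_span]
    exact Submodule.span_mono hsub
  obtain ⟨F, hF, hFf⟩ := Submodule.mem_map.1 (hle hf)
  exact ⟨F, hF, fun g => by rw [← hFf, LinearMap.funLeft_apply]⟩

/-- **Colour-cell universality** (registered stub `colourSeparated_blowup` of crux
`stmt-MatrixMultiplication-7610`, line `schur-weyl-colour-cells`): for `1 ≤ s` and `r ≤ 2^s` the
blow-up `ι : 𝔖ₘ →* 𝔖_{m s}` is injective and carries every triple `X, Y, Z ⊆ 𝔖ₘ` separated by the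
`r`-colour cell `J_r(m) = span{[c' ∘ g = c]}` (the separation clause of `GradedDesignFamily`) to the
triple `ι X, ι Y, ι Z ⊆ 𝔖_{m s}` separated by the two-colour cell `J_2(m s)`, verbatim. [folklore] -/
theorem colourSeparated_blowup (m s r : ℕ) (hs : 1 ≤ s) (hr : r ≤ 2 ^ s) (X Y Z : Finset (Equiv.Perm (Fin m))) (hsep : ∀ x₀ ∈ X, ∀ z₀ ∈ Z, ∃ f ∈ Submodule.span ℂ {f : Equiv.Perm (Fin m) → ℂ | ∃ c c' : Fin m → Fin r, f = fun g : Equiv.Perm (Fin m) => if c' ∘ (⇑g) = c then (1 : ℂ) else 0}, ∀ x ∈ X, ∀ y ∈ Y, ∀ y' ∈ Y, ∀ z ∈ Z, (x = x₀ ∧ y = y' ∧ z = z₀ → f (x⁻¹ * y * y'⁻¹ * z) = 1) ∧ (¬ (x = x₀ ∧ y = y' ∧ z = z₀) → f (x⁻¹ * y * y'⁻¹ * z) = 0)) : ∃ ι : Equiv.Perm (Fin m) →* Equiv.Perm (Fin (m * s)), Function.Injective ι ∧ ∀ x₀ ∈ X.image ι, ∀ z₀ ∈ Z.image ι, ∃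 f ∈ Submodule.span ℂ {f : Equiv.Perm (Fin (m * s)) → ℂ | ∃ c c' : Fin (m * s) → Fin 2, f = fun g : Equiv.Perm (Fin (m * s)) => if c' ∘ (⇑g) = c then (1 : ℂ) else 0}, ∀ x ∈ X.image ι, ∀ y ∈ Y.image ι, ∀ y' ∈ Y.image ι, ∀ z ∈ Z.image ι, (x = x₀ ∧ y = y' ∧ z = z₀ → f (x⁻¹ * y * y'⁻¹ * z) = 1) ∧ (¬ (x = x₀ ∧ y = y' ∧ z = z₀) → f (x⁻¹ * y * y'⁻¹ * z) = 0) := by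
  obtain ⟨ι, hinj, hcol⟩ := sigmaBlowup_exists m s r hs hr
  refine ⟨ι, hinj, ?_⟩
  intro x₀ hx₀ z₀ hz₀
  obtain ⟨a₀, ha₀, rfl⟩ := Finset.mem_image.1 hx₀
  obtain ⟨d₀, hd₀, rfl⟩ := Finset.mem_image.1 hz₀
  obtain ⟨f, hf, hpat⟩ := hsep a₀ ha₀ d₀ hd₀
  obtain ⟨F, hF, hFf⟩ := sigmaBlowup_span_transfer ι hcol hf
  refine ⟨F, hF, ?_⟩
  intro x hx y hy y' hy' z hz
  obtain ⟨a, ha, rfl⟩ := Finset.mem_image.1 hx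
  obtain ⟨b, hb, rfl⟩ := Finset.mem_image.1 hy
  obtain ⟨b', hb', rfl⟩ := Finset.mem_image.1 hy'
  obtain ⟨d, hd, rfl⟩ := Finset.mem_image.1 hz
  have hprod : (ι a)⁻¹ * ι b * (ι b')⁻¹ * ι d = ι (a⁻¹ * b * b'⁻¹ * d) := by
    simp only [map_mul, map_inv]
  have hiff : (ι a = ι a₀ ∧ ι b = ι b' ∧ ι d = ι d₀) ↔ (a = a₀ ∧ b = b' ∧ d = d₀) := by
    simp only [hinj.eq_iff]
  rw [hprod, hFf, hiff]
  exact hpat a ha b hb b' hb' d hd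

end Summit.MatrixMultiplication.MatrixMultiplication.Theorems.GradedDesignFamily.SigmaBlowup

end
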